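import Summits.QuantumFields.BalabanUV.T4Continuum.Support.GradedWellGramPairing
import Summits.QuantumFields.BalabanUV.T4Continuum.Support.GaugeProjectionTwoLevel
import Summits.QuantumFields.BalabanUV.T4Continuum.Support.EffectiveLaplacianExcess
import Summits.QuantumFields.BalabanUV.T4Continuum.Support.BalabanAveragedCoerciveTower

/-!
# T⁴ programme, spine node NE2 (U1a), sub-row Δ1 — THE GRADED WELL, crew socket (GW-K) part 2b:
# THE TWO-LEVEL LAW OF THE GRADED SCALAR GRAM MATRIX `‖(KGWL k)⁻¹ − (KGW k)⁻¹‖ ≤ CkGW·L^{−k}`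

NE2 formalisation swarm, leaf-05 (gen 10), socket **(GW-K)** of RULINGS R48/R49 (journal 2026-08-21), second half, on O16-d
`GradedWellTwoLevel` (`KGW := gramK GOmGW QsGWn`, `KGWL k hk := (KGW (k+1)).submatrix rowSLift rowSLift`), part 1 `GradedWellGram`
(`‖KGW⁻¹‖ ≤ σ_GW⁻²` level-free), part 2a `GradedWellGramPairing` (`(Q′ₙ(k+1)∘rowSLift)·J₀ = Q′ₙ(k)`, `Δ′_GW = Δ′ + V`, `V′J₀ = J₀V`,
`‖V‖ ≤ vGW`), leaf-05-g9's generic `GaugeProjectionTwoLevel.opNorm_inv_gramK_sub_twoLevel_le` and tier B4.d's torus numbers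
`EffectiveLaplacianExcess.freeTowerLaws_king_scalar` (`e₀ = c₀·L^{−k}`, `e₁ = c₁·L^{−k}`).
 * §4 RESOLVENT TRANSFER: **`inv_mul_sub_mul_inv_eq`** `(D₀′+V′)⁻¹J − J(D₀+V)⁻¹ = ((D₀′+V′)⁻¹D₀′)·(D₀′⁻¹J − JD₀⁻¹)·(D₀(D₀+V)⁻¹)` for
   `V′J = JV`; `opNorm_one_sub_mul_le`, `opNorm_one_sub_mul_mul_one_sub_le`; the graded numbers
   **`opNorm_GOmGW_injected_le : ‖G′_GW(k+1)J₀ − J₀G′_GW(k)‖ ≤ (1 + g·vGW)²·c₁·L^{−k}`**,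
   **`opNorm_GOmGW_complement_le : ‖G′_GW(k+1)(1 − J₀J₀ᴴ)‖ ≤ (1 + g·vGW)·c₀·L^{−k}`**;
 * §5 ASSEMBLY: `opNorm_submatrix_le_one`, `gram_lift_eq`, `CkGW`, and
   **`opNorm_inv_KGWL_sub_inv_KGW_le (hk : m ≤ k) (hd) (ha′) (hD) (hD′) (hg) (hg′) :
   ‖(KGWL L M k m layer a′ hk)⁻¹ − (KGW L M k m layer a′)⁻¹‖ ≤ CkGW d L m a′ g · (L⁻¹)^k`** — R48's `hKε` with `Ck` LEVEL-FREE
   (`d, L, m, a′`, and the cap `g ≥ ‖G′_GW‖` of O16-e, `g = gamGW⁻¹`).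

HONEST FRAMING (T4-DAG p. 1).  [folklore] finite-dimensional resolvent algebra at model level (`U = 1`, one layer map, `m ≤ k`, finite torus,
operator norm); constants ours; NE2 (U1a) NOT proved; spine PROVED 0/9 unchanged; NOT [B9] (3.16)/(3.23)–(3.27)/(3.42) as printed; NOT
infinite volume / mass gap / Clay.  HONEST DEPENDENCY: continuum YM on T⁴ ⇐ BetaPertH ∧ nine spine estimates (0/9 proved); BetaPertH ⇐
(D1) ∧ (D4) ∧ CAP+tail; G-an2-4 gates asym, D1 and NE2/3/4.  No `sorry`.
-/

noncomputable section

open scoped BigOperators ComplexConjugate Matrix Matrix.Norms.L2Operator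
open Finset

namespace Summit.QuantumFields.BalabanUV.T4Continuum.GradedWellGramTwoLevel

open Literature.MathematicalPhysics.QuantumFieldTheory.Balaban1983to89.B5Prop11Plancherel (Tor fine opNorm_le_of_sq_le)
open Literature.MathematicalPhysics.QuantumFieldTheory.Balaban1983to89.B5Prop11Lower (nsq nsq_nonneg star_dotProduct_self nsq_mulVec_le)
open Literature.MathematicalPhysics.QuantumFieldTheory.Balaban1983to89.B5Blocks16 (blockOf)
open Literature.MathematicalPhysics.QuantumFieldTheory.Balaban1983to89.B5G183RateTorus (cpt)
open Literature.MathematicalPhysics.QuantumFieldTheory.Balaban1983to89.B5G183RateUnitTower (lev lev_neZero)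
open Summit.QuantumFields.BalabanUV.T4Continuum
open Summit.QuantumFields.BalabanUV.T4Continuum.ScalarBlockPoincare (PiS nsq_PiS_mulVec_le nsq_smul)
open Summit.QuantumFields.BalabanUV.T4Continuum.ScalarAveragedPropagator (DeltaPs gammaPs)
open Summit.QuantumFields.BalabanUV.T4Continuum.ScalarBlockPlanting (JK0 Qavg0 star_Qavg0_apply Qavg0_mul_apply
  Qavg0_conjTranspose_mul_apply)
open Summit.QuantumFields.BalabanUV.T4Continuum.ScalarPlantingDefect (J0pcT PiS_succ_mul_J0pcT opNorm_J0pcT_le)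
open Literature.MathematicalPhysics.QuantumFieldTheory.Balaban1983to89.B5G183RateTorusW (off)
open Summit.QuantumFields.BalabanUV.T4Continuum.BalabanAveragedTowerModes (par val_par par_cpt_add_off)
open Summit.QuantumFields.BalabanUV.T4Continuum.EffectiveLaplacianExcess (CX CX_nonneg freeTowerLaws_king_scalar)
open Summit.QuantumFields.BalabanUV.T4Continuum.RegionGaugeProjection (gramK)
open Summit.QuantumFields.BalabanUV.T4Continuum.RegionGaugeSlice (form_gram)
open Summit.QuantumFields.BalabanUV.T4Continuum.GaugeProjectionTwoLevel (gramK_eq_mul_conjTranspose opNorm_inv_gramK_sub_twoLevel_le)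
open Summit.QuantumFields.BalabanUV.T4Continuum.BalabanAveragedCoerciveTower (opNorm_submatrix_equiv)
open Summit.QuantumFields.BalabanUV.T4Continuum.GradedSubBlocks (Anchor Anc InSub meanS s_pos)
open Summit.QuantumFields.BalabanUV.T4Continuum.GradedWellData
open Summit.QuantumFields.BalabanUV.T4Continuum.GradedWellSlice (QsGWn QsGWn_mul_conjTranspose)
open Summit.QuantumFields.BalabanUV.T4Continuum.GradedWellTwoLevel (val_cpt' sGW_succ anchor_lift rowSLift KGW KGWL)
open Summit.QuantumFields.BalabanUV.T4Continuum.GradedWellGram (sigGW sigGW_pos isUnit_det_gramK_GW opNorm_inv_gramK_GW_le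
  nsq_mulVec_le_of_mul_conjTranspose_eq_one)

open Summit.QuantumFields.BalabanUV.T4Continuum.GradedWellGramPairing
variable {d : ℕ} (L : ℕ) [NeZero L] (M : Fin d → ℕ) [hM : ∀ μ, NeZero (M μ)] (k m : ℕ) (layer : Tor M → ℕ) (a' : ℝ)

/-! ## §4 Resolvent transfer: the graded `es`, `ec` from the torus numbers -/

section Transfer

variable {n n' : Type*} [Fintype n] [DecidableEq n] [Fintype n'] [DecidableEq n']

/-- **RESOLVENT TRANSFER IDENTITY**: for `V′J = JV`,
`(D₀′+V′)⁻¹J − J(D₀+V)⁻¹ = ((D₀′+V′)⁻¹D₀′)·(D₀′⁻¹J − JD₀⁻¹)·(D₀(D₀+V)⁻¹)`. [folklore] -/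
theorem inv_mul_sub_mul_inv_eq (D₀ V : Matrix n n ℂ) (D₀' V' : Matrix n' n' ℂ) (J : Matrix n' n ℂ)
    (h : IsUnit (D₀ + V).det) (h' : IsUnit (D₀' + V').det) (h₀ : IsUnit D₀.det) (h₀' : IsUnit D₀'.det)
    (hVJ : V' * J = J * V) :
    (D₀' + V')⁻¹ * J - J * (D₀ + V)⁻¹
      = ((D₀' + V')⁻¹ * D₀') * (D₀'⁻¹ * J - J * D₀⁻¹) * (D₀ * (D₀ + V)⁻¹) := by
  have e2 : D₀ * (D₀ + V)⁻¹ = 1 - V * (D₀ + V)⁻¹ := by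
    rw [eq_sub_iff_add_eq, ← Matrix.add_mul, Matrix.mul_nonsing_inv _ h]
  have e3 : (D₀' + V')⁻¹ * D₀' = 1 - (D₀' + V')⁻¹ * V' := by
    rw [eq_sub_iff_add_eq, ← Matrix.mul_add, Matrix.nonsing_inv_mul _ h']
  have e1 : ((D₀' + V')⁻¹ * D₀') * (D₀'⁻¹ * J - J * D₀⁻¹) * (D₀ * (D₀ + V)⁻¹)
      = (D₀' + V')⁻¹ * (D₀' * D₀'⁻¹) * J * (D₀ * (D₀ + V)⁻¹)
        - ((D₀' + V')⁻¹ * D₀') * J * (D₀⁻¹ * D₀) * (D₀ + V)⁻¹ := by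
    simp only [Matrix.mul_sub, Matrix.sub_mul, Matrix.mul_assoc]
  rw [e1, Matrix.mul_nonsing_inv _ h₀', Matrix.nonsing_inv_mul _ h₀, Matrix.mul_one, Matrix.mul_one, e2, e3,
    Matrix.mul_sub, Matrix.mul_one, Matrix.sub_mul, Matrix.sub_mul, Matrix.one_mul,
    Matrix.mul_assoc ((D₀' + V')⁻¹) V' J, hVJ]
  simp only [Matrix.mul_assoc]
  abel

/-- `‖(1 − A)·Y‖ ≤ (1 + ‖A‖)·‖Y‖`. [folklore] -/
theorem opNorm_one_sub_mul_le (A : Matrix n' n' ℂ) (Y : Matrix n' n ℂ) : ‖(1 - A) * Y‖ ≤ (1 + ‖A‖) * ‖Y‖ := by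
  rw [Matrix.sub_mul, Matrix.one_mul]
  calc ‖Y - A * Y‖ ≤ ‖Y‖ + ‖A * Y‖ := norm_sub_le _ _
    _ ≤ ‖Y‖ + ‖A‖ * ‖Y‖ := by gcongr; exact Matrix.l2_opNorm_mul _ _
    _ = (1 + ‖A‖) * ‖Y‖ := by ring

/-- `‖(1 − A)·Y·(1 − B)‖ ≤ (1 + ‖A‖)·‖Y‖·(1 + ‖B‖)`. [folklore] -/
theorem opNorm_one_sub_mul_mul_one_sub_le (A : Matrix n' n' ℂ) (Y : Matrix n' n ℂ) (B : Matrix n n ℂ) :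
    ‖(1 - A) * Y * (1 - B)‖ ≤ (1 + ‖A‖) * ‖Y‖ * (1 + ‖B‖) := by
  have h1 := opNorm_one_sub_mul_le A Y
  rw [Matrix.mul_sub, Matrix.mul_one]
  calc ‖(1 - A) * Y - (1 - A) * Y * B‖ ≤ ‖(1 - A) * Y‖ + ‖(1 - A) * Y * B‖ := norm_sub_le _ _
    _ ≤ ‖(1 - A) * Y‖ + ‖(1 - A) * Y‖ * ‖B‖ := by gcongr; exact Matrix.l2_opNorm_mul _ _
    _ = ‖(1 - A) * Y‖ * (1 + ‖B‖) := by ring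
    _ ≤ (1 + ‖A‖) * ‖Y‖ * (1 + ‖B‖) := mul_le_mul_of_nonneg_right h1 (by positivity)

end Transfer

/-- the torus numbers' constants: `c₀ = 2d√(γ′⁻¹)` (complement) and `c₁ = c₀ + CX` (injected). [folklore] -/
def c0K (d : ℕ) (a' : ℝ) : ℝ := 2 * d * Real.sqrt ((gammaPs d a')⁻¹)

/-- `c₁ = c₀ + CX d a′`. [folklore] -/
def c1K (d : ℕ) (a' : ℝ) : ℝ := 2 * d * Real.sqrt ((gammaPs d a')⁻¹) + CX d a'

omit hM in
/-- `0 ≤ c₀ ≤ c₁`. [folklore] -/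
theorem c0K_nonneg : 0 ≤ c0K d a' ∧ c0K d a' ≤ c1K d a' := by
  unfold c0K c1K
  exact ⟨by positivity, le_add_of_nonneg_right (CX_nonneg d a')⟩

/-- **THE GRADED INJECTED DEFECT**: `‖G′_GW(k+1)·J₀ − J₀·G′_GW(k)‖ ≤ (1 + g·v_GW)²·c₁·L^{−k}`. [folklore] -/
theorem opNorm_GOmGW_injected_le (hk : m ≤ k) (hd : 0 < d) (ha' : 0 < a') (hD : IsUnit (DpGW L M k m layer a').det)
    (hD' : IsUnit (DpGW L M (k + 1) m layer a').det) {g : ℝ} (hg : ‖GOmGW L M k m layer a'‖ ≤ g)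
    (hg' : ‖GOmGW L M (k + 1) m layer a'‖ ≤ g) :
    ‖GOmGW L M (k + 1) m layer a' * J0pcT L M k - J0pcT L M k * GOmGW L M k m layer a'‖
      ≤ (1 + g * vGW L m a') ^ 2 * c1K d a' * ((L : ℝ)⁻¹) ^ k := by
  have hT := freeTowerLaws_king_scalar L M hd ha'
  have h0 : 0 ≤ g := (norm_nonneg _).trans hg
  have hv := opNorm_VGW_le L M k m layer a'
  have hv' := opNorm_VGW_le L M (k + 1) m layer a'
  have hv0 : 0 ≤ vGW L m a' := (norm_nonneg _).trans hv
  have hDV : IsUnit (DeltaPs (lev L k) M a' + VGW L M k m layer a').det := by rw [← DpGW_eq_DeltaPs_add]; exact hD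
  have hDV' : IsUnit (DeltaPs (lev L (k + 1)) M a' + VGW L M (k + 1) m layer a').det := by
    rw [← DpGW_eq_DeltaPs_add]; exact hD'
  have e : GOmGW L M (k + 1) m layer a' * J0pcT L M k - J0pcT L M k * GOmGW L M k m layer a'
      = (1 - GOmGW L M (k + 1) m layer a' * VGW L M (k + 1) m layer a') *
          ((DeltaPs (lev L (k + 1)) M a')⁻¹ * J0pcT L M k - J0pcT L M k * (DeltaPs (lev L k) M a')⁻¹) *
          (1 - VGW L M k m layer a' * GOmGW L M k m layer a') := by
    unfold GOmGW
    rw [DpGW_eq_DeltaPs_add, DpGW_eq_DeltaPs_add,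
      inv_mul_sub_mul_inv_eq _ _ _ _ _ hDV hDV' (hT.isUnit_det k) (hT.isUnit_det (k + 1)) (VGW_succ_mul_J0 L M k m layer a' hk)]
    congr 2
    · rw [eq_sub_iff_add_eq, ← Matrix.mul_add, Matrix.nonsing_inv_mul _ hDV']
    · rw [eq_sub_iff_add_eq, ← Matrix.add_mul, Matrix.mul_nonsing_inv _ hDV]
  rw [e]
  refine (opNorm_one_sub_mul_mul_one_sub_le _ _ _).trans ?_
  have h1 : ‖GOmGW L M (k + 1) m layer a' * VGW L M (k + 1) m layer a'‖ ≤ g * vGW L m a' :=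
    (Matrix.l2_opNorm_mul _ _).trans (mul_le_mul hg' hv' (norm_nonneg _) h0)
  have h2 : ‖VGW L M k m layer a' * GOmGW L M k m layer a'‖ ≤ g * vGW L m a' := by
    rw [mul_comm g]
    exact (Matrix.l2_opNorm_mul _ _).trans (mul_le_mul hv hg (norm_nonneg _) hv0)
  have h3 := hT.injected_le k
  have hc : 0 ≤ c1K d a' * ((L : ℝ)⁻¹) ^ k := mul_nonneg ((c0K_nonneg a' (d := d)).1.trans (c0K_nonneg a' (d := d)).2) (by positivity)
  calc (1 + ‖GOmGW L M (k + 1) m layer a' * VGW L M (k + 1) m layer a'‖) *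
        ‖(DeltaPs (lev L (k + 1)) M a')⁻¹ * J0pcT L M k - J0pcT L M k * (DeltaPs (lev L k) M a')⁻¹‖ *
        (1 + ‖VGW L M k m layer a' * GOmGW L M k m layer a'‖)
      ≤ (1 + g * vGW L m a') * (c1K d a' * ((L : ℝ)⁻¹) ^ k) * (1 + g * vGW L m a') :=
        mul_le_mul (mul_le_mul (by linarith) h3 (norm_nonneg _) (by positivity)) (by linarith) (by positivity)
          (by positivity)
    _ = (1 + g * vGW L m a') ^ 2 * c1K d a' * ((L : ℝ)⁻¹) ^ k := by ring

/-- **THE GRADED COMPLEMENT DEFECT**: `‖G′_GW(k+1)·(1 − J₀J₀ᴴ)‖ ≤ (1 + g·v_GW)·c₀·L^{−k}`. [folklore] -/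
theorem opNorm_GOmGW_complement_le (hd : 0 < d) (ha' : 0 < a') (hD' : IsUnit (DpGW L M (k + 1) m layer a').det)
    {g : ℝ} (hg' : ‖GOmGW L M (k + 1) m layer a'‖ ≤ g) :
    ‖GOmGW L M (k + 1) m layer a' * (1 - J0pcT L M k * (J0pcT L M k)ᴴ)‖
      ≤ (1 + g * vGW L m a') * c0K d a' * ((L : ℝ)⁻¹) ^ k := by
  have hT := freeTowerLaws_king_scalar L M hd ha'
  have h0 : 0 ≤ g := (norm_nonneg _).trans hg'
  have hv' := opNorm_VGW_le L M (k + 1) m layer a'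
  have hDV' : IsUnit (DeltaPs (lev L (k + 1)) M a' + VGW L M (k + 1) m layer a').det := by
    rw [← DpGW_eq_DeltaPs_add]; exact hD'
  have e : GOmGW L M (k + 1) m layer a' * (1 - J0pcT L M k * (J0pcT L M k)ᴴ)
      = (1 - GOmGW L M (k + 1) m layer a' * VGW L M (k + 1) m layer a') *
          ((DeltaPs (lev L (k + 1)) M a')⁻¹ * (1 - J0pcT L M k * (J0pcT L M k)ᴴ)) := by
    have e1 : (1 - GOmGW L M (k + 1) m layer a' * VGW L M (k + 1) m layer a')
        = GOmGW L M (k + 1) m layer a' * DeltaPs (lev L (k + 1)) M a' := by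
      unfold GOmGW
      rw [DpGW_eq_DeltaPs_add, sub_eq_iff_eq_add, ← Matrix.mul_add, Matrix.nonsing_inv_mul _ hDV']
    rw [e1, Matrix.mul_assoc, ← Matrix.mul_assoc (DeltaPs _ _ _), Matrix.mul_nonsing_inv _ (hT.isUnit_det (k + 1)),
      Matrix.one_mul]
  rw [e]
  refine (opNorm_one_sub_mul_le _ _).trans ?_
  have h1 : ‖GOmGW L M (k + 1) m layer a' * VGW L M (k + 1) m layer a'‖ ≤ g * vGW L m a' :=
    (Matrix.l2_opNorm_mul _ _).trans (mul_le_mul hg' hv' (norm_nonneg _) h0)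
  have h3 := hT.complement_le k
  have hc : 0 ≤ c0K d a' * ((L : ℝ)⁻¹) ^ k := mul_nonneg (c0K_nonneg a' (d := d)).1 (by positivity)
  calc (1 + ‖GOmGW L M (k + 1) m layer a' * VGW L M (k + 1) m layer a'‖) *
        ‖(DeltaPs (lev L (k + 1)) M a')⁻¹ * (1 - J0pcT L M k * (J0pcT L M k)ᴴ)‖
      ≤ (1 + g * vGW L m a') * (c0K d a' * ((L : ℝ)⁻¹) ^ k) :=
        mul_le_mul (by linarith) h3 (norm_nonneg _) (by linarith [mul_nonneg h0 ((norm_nonneg _).trans hv')])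
    _ = (1 + g * vGW L m a') * c0K d a' * ((L : ℝ)⁻¹) ^ k := by ring

/-! ## §5 Assembly: the two-level law of the Gram matrix -/

/-- `‖Q.submatrix e id‖ ≤ 1` for orthonormal rows `Q·Qᴴ = 1` and a row relabelling `e`. [folklore] -/
theorem opNorm_submatrix_le_one {ι u' v' : Type*} [Fintype ι] [DecidableEq ι] [Fintype u'] [DecidableEq u']
    [Fintype v'] [DecidableEq v'] (Q : Matrix u' v' ℂ) (hQ : Q * Qᴴ = 1) (e : ι ≃ u') :
    ‖Q.submatrix e id‖ ≤ 1 := by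
  refine CovariantBlockAveraging.opNorm_le_of_sq_le' _ zero_le_one fun x => ?_
  have h1 : nsq (Q.submatrix e id *ᵥ x) ≤ nsq x := by
    have h2 : nsq (Q.submatrix e id *ᵥ x) = nsq (Q *ᵥ x) := by
      unfold nsq
      exact e.sum_comp (fun i => ‖(Q *ᵥ x) i‖ ^ 2)
    rw [h2]
    exact nsq_mulVec_le_of_mul_conjTranspose_eq_one Q hQ x
  rw [one_pow, one_mul]
  exact h1

/-- the lifted Gram matrix is the relabelled one: `Q′G′(Q′G′)ᴴ = (gramK G′ Q′ₙ(k+1)).submatrix e e` for `Q′ = Q′ₙ(k+1)∘e`. [folklore] -/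
theorem gram_lift_eq {ι u' v' : Type*} [Fintype u'] [Fintype v'] (Q : Matrix u' v' ℂ) (G : Matrix v' v' ℂ)
    (hG : G.IsHermitian) (e : ι ≃ u') :
    Q.submatrix e id * G * (Q.submatrix e id * G)ᴴ = (gramK G Q).submatrix e e := by
  rw [← gramK_eq_mul_conjTranspose hG]
  unfold gramK
  ext i j
  simp only [Matrix.submatrix_apply, Matrix.mul_apply, Matrix.conjTranspose_apply, id]

/-- the level-free constant of the two-level law. [folklore] -/
def CkGW (d L m : ℕ) (a' g : ℝ) : ℝ :=
  ((sigGW d L m a') ^ 2)⁻¹ * (1 * 1 * (2 * g + (1 + g * vGW L m a') ^ 2 * c1K d a') *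
    ((1 + g * vGW L m a') ^ 2 * c1K d a' + (1 + g * vGW L m a') * c0K d a')) * ((sigGW d L m a') ^ 2)⁻¹

/-- **SOCKET (GW-K), part 2: THE TWO-LEVEL LAW OF THE GRADED SCALAR GRAM MATRIX**
`‖(KGWL k)⁻¹ − (KGW k)⁻¹‖ ≤ CkGW·L^{−k}` for `k ≥ m`, with `CkGW` depending on `d, L, m, a′` and the level-free cap `g ≥ ‖G′_GW‖`
(O16-e: `g = gamGW⁻¹`) only. [folklore] -/
theorem opNorm_inv_KGWL_sub_inv_KGW_le (hk : m ≤ k) (hd : 0 < d) (ha' : 0 < a')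
    (hD : IsUnit (DpGW L M k m layer a').det) (hD' : IsUnit (DpGW L M (k + 1) m layer a').det)
    {g : ℝ} (hg : ‖GOmGW L M k m layer a'‖ ≤ g) (hg' : ‖GOmGW L M (k + 1) m layer a'‖ ≤ g) :
    ‖(KGWL L M k m layer a' hk)⁻¹ - (KGW L M k m layer a')⁻¹‖ ≤ CkGW d L m a' g * ((L : ℝ)⁻¹) ^ k := by
  have hL1 : (1 : ℝ) ≤ L := by exact_mod_cast Nat.one_le_iff_ne_zero.mpr (NeZero.ne L)
  have hθ : ((L : ℝ)⁻¹) ^ k ≤ 1 := pow_le_one₀ (by positivity) (inv_le_one_of_one_le₀ hL1)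
  have hθ0 : 0 ≤ ((L : ℝ)⁻¹) ^ k := by positivity
  have h0 : 0 ≤ g := (norm_nonneg _).trans hg
  have hv0 : 0 ≤ vGW L m a' := (norm_nonneg _).trans (opNorm_VGW_le L M k m layer a')
  have hGh := GOmGW_isHermitian L M k m layer a'
  have hGh' := GOmGW_isHermitian L M (k + 1) m layer a'
  set e := rowSLift L M k m layer hk with he
  have eK : KGW L M k m layer a' = QsGWn L M k m layer * GOmGW L M k m layer a' *
      (QsGWn L M k m layer * GOmGW L M k m layer a')ᴴ := gramK_eq_mul_conjTranspose hGh _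
  have eK' : KGWL L M k m layer a' hk = (QsGWn L M (k + 1) m layer).submatrix e id * GOmGW L M (k + 1) m layer a' *
      ((QsGWn L M (k + 1) m layer).submatrix e id * GOmGW L M (k + 1) m layer a')ᴴ := by
    rw [gram_lift_eq _ _ hGh']; rfl
  have hK := isUnit_det_gramK_GW L M k m layer a' hD ha'
  have hK1 := isUnit_det_gramK_GW L M (k + 1) m layer a' hD' ha'
  have hki := opNorm_inv_gramK_GW_le L M k m layer a' hD ha'
  have hki1 := opNorm_inv_gramK_GW_le L M (k + 1) m layer a' hD' ha'
  have hK' : IsUnit ((QsGWn L M (k + 1) m layer).submatrix e id * GOmGW L M (k + 1) m layer a' *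
      ((QsGWn L M (k + 1) m layer).submatrix e id * GOmGW L M (k + 1) m layer a')ᴴ).det := by
    rw [gram_lift_eq _ _ hGh', Matrix.det_submatrix_equiv_self]; exact hK1
  have hN' : ‖((QsGWn L M (k + 1) m layer).submatrix e id * GOmGW L M (k + 1) m layer a' *
      ((QsGWn L M (k + 1) m layer).submatrix e id * GOmGW L M (k + 1) m layer a')ᴴ)⁻¹‖ ≤ ((sigGW d L m a') ^ 2)⁻¹ := by
    rw [gram_lift_eq _ _ hGh', Matrix.inv_submatrix_equiv, opNorm_submatrix_equiv]; exact hki1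
  have hes := opNorm_GOmGW_injected_le L M k m layer a' hk hd ha' hD hD' hg hg'
  have hec := opNorm_GOmGW_complement_le L M k m layer a' hd ha' hD' hg'
  have hc := c0K_nonneg a' (d := d)
  have hesE : (1 + g * vGW L m a') ^ 2 * c1K d a' * ((L : ℝ)⁻¹) ^ k ≤ (1 + g * vGW L m a') ^ 2 * c1K d a' :=
    mul_le_of_le_one_right (mul_nonneg (sq_nonneg _) (hc.1.trans hc.2)) hθ
  have h := opNorm_inv_gramK_sub_twoLevel_le (QsGWn_lift_mul_J0 L M k m layer hk) (by rw [← eK]; exact hK) hK'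
    (opNorm_submatrix_le_one _ (QsGWn_mul_conjTranspose L M (k + 1) m layer) e) (opNorm_J0pcT_le L M k) hg hg'
    (by rw [← eK]; exact hki) hN' hes hec hesE
  rw [eK', eK]
  refine h.trans (le_of_eq ?_)
  unfold CkGW
  ring

end Summit.QuantumFields.BalabanUV.T4Continuum.GradedWellGramTwoLevel

end
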